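import Mathlib
import HarnessLib
import Summits.HubbardSuperconductivity.HubbardSuperconductivity.Theorems.KLProgrammeKLRegimeCountertermV7Volume

/-!
# Route `KLProgramme` — child `KLRegimeCounterterm` (gen 3): closed forms and geometric sums of the two-leg majorants used by the
# wholesale continuation (seat hubbard-kl-k3c3-p2)

`twoLegBar G Q U 0 i = (S 0 + S′ 0|U|)|U|·16^{-i}`, `lipBar G Q U i = (SL + SL′|U|)|U|·4^{-i}`, the tolerance
`cr·|U|·Λ_n²/e₀ = cr·|U|/32·16^{-n}`, and the sums `Σ_{i<m} lipBar ≤ (4/3)(SL+SL′|U|)|U|` (the contraction factor of child 2's map),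
`Σ_{i∈Ico (j+1)(n+1)} twoLegBar 0 i ≤ twoLegBar 0 j / 15` (the tail), monotonicity of `twoLegBar 0`.  Proofs only.
-/

noncomputable section

namespace Summit.HubbardSuperconductivity.HubbardSuperconductivity.Theorems.KLRegimeSplit

set_option linter.dupNamespace false -- summit = problem name (single-conjunct summit), D-0017

open Real Finset
open Literature.MathematicalPhysics.QuantumLattice Literature.Probability.LatticeModels
open Summit.HubbardSuperconductivity.HubbardSuperconductivity.Theorems.KLProgrammeLegKernels

/-! ## §1 Closed forms and sums of the majorants -/

/-- `twoLegBar G Q U 0 i = (S 0 + S′ 0·|U|)·|U|·(16^i)⁻¹`. -/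
theorem ct_twoLegBar_zero_eq (G : GeoConsts) (Q : EngConsts) (U : ℝ) (i : ℕ) :
    twoLegBar G Q U 0 i = (G.S 0 + Q.S' 0 * |U|) * |U| * ((16 : ℝ) ^ i)⁻¹ := by
  unfold twoLegBar
  have h : (4 : ℝ) ^ ((((0 : ℕ) : ℤ) - 2) * (i : ℤ)) = ((16 : ℝ) ^ i)⁻¹ := by
    rw [show (((0 : ℕ) : ℤ) - 2) * (i : ℤ) = -((2 * i : ℕ) : ℤ) by push_cast; ring, zpow_neg, zpow_natCast, pow_mul]
    norm_num
  rw [h, uPow_zero]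

/-- `lipBar G Q U i = (SL + SL′·|U|)·|U|·(4^i)⁻¹` (definitional). -/
theorem ct_lipBar_eq (G : GeoConsts) (Q : EngConsts) (U : ℝ) (i : ℕ) :
    lipBar G Q U i = (G.SL + Q.SL * |U|) * |U| * ((4 : ℝ) ^ i)⁻¹ := rfl

/-- The renormalisation tolerance in closed form: `cr·|U|·Λ_n²/e₀ = cr·|U|/32·(16^n)⁻¹`. -/
theorem ct_tol_eq (cr U : ℝ) (n : ℕ) :
    cr * |U| * klScale klE0 n ^ 2 / klE0 = cr * |U| / 32 * ((16 : ℝ) ^ n)⁻¹ := by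
  unfold klScale klE0
  have h16 : (16 : ℝ) ^ n = 4 ^ n * 4 ^ n := by rw [← mul_pow]; norm_num
  rw [h16]
  have h4 : (4 : ℝ) ^ n ≠ 0 := pow_ne_zero _ (by norm_num)
  field_simp

/-- **Summed frame-Lipschitz majorants**: `Σ_{i<m} lipBar ≤ (4/3)·(SL + SL′|U|)·|U|`. -/
theorem ct_sum_lipBar_le {G : GeoConsts} {Q : EngConsts} (hG : G.WF) (hQ : Q.WF) (U : ℝ) (m : ℕ) :
    ∑ i ∈ range m, lipBar G Q U i ≤ 4 / 3 * (G.SL + Q.SL * |U|) * |U| := by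
  have hSL : 0 ≤ G.SL := hG.2.2.2.2.2.2.2.2.2.2.2.2.2.2.2.2.2.2.2
  have hSL' : 0 ≤ Q.SL := hQ.2.2.2.2.2.2.1
  have hc : 0 ≤ (G.SL + Q.SL * |U|) * |U| := by positivity
  simp_rw [ct_lipBar_eq]
  rw [← mul_sum]
  have hgeom : ∑ i ∈ range m, ((4 : ℝ) ^ i)⁻¹ ≤ 4 / 3 := by
    have h1 : ∑ i ∈ range m, ((4 : ℝ) ^ i)⁻¹ = ∑ i ∈ range m, ((1 : ℝ) / 4) ^ i :=
      sum_congr rfl fun i _ => by rw [one_div, inv_pow]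
    rw [h1, Finset.range_eq_Ico]
    exact (geom_sum_Ico_le_of_lt_one (m := 0) (n := m) (x := (1 : ℝ) / 4) (by norm_num) (by norm_num)).trans (by norm_num)
  nlinarith

/-- **The tail of the zeroth-order sizes**: `Σ_{i ∈ Ico (j+1) (n+1)} twoLegBar 0 i ≤ twoLegBar 0 j / 15`. -/
theorem ct_sum_Ico_twoLegBar_zero_le {G : GeoConsts} {Q : EngConsts} (hG : G.WF) (hQ : Q.WF) (U : ℝ) (j n : ℕ) :
    ∑ i ∈ Ico (j + 1) (n + 1), twoLegBar G Q U 0 i ≤ twoLegBar G Q U 0 j / 15 := by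
  have hS : 0 ≤ G.S 0 := hG.2.2.2.2.2.2.2.2.2.2.2.2.2.2.2.2.2.1 0
  have hS' : 0 ≤ Q.S' 0 := hQ.2.2.2.2.1 0
  have hc : 0 ≤ (G.S 0 + Q.S' 0 * |U|) * |U| := by positivity
  simp_rw [ct_twoLegBar_zero_eq]
  rw [← mul_sum, mul_div_assoc]
  refine mul_le_mul_of_nonneg_left ?_ hc
  have h1 : ∑ i ∈ Ico (j + 1) (n + 1), ((16 : ℝ) ^ i)⁻¹ = ∑ i ∈ Ico (j + 1) (n + 1), ((1 : ℝ) / 16) ^ i :=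
    sum_congr rfl fun i _ => by rw [one_div, inv_pow]
  rw [h1]
  refine (geom_sum_Ico_le_of_lt_one (m := j + 1) (n := n + 1) (x := (1 : ℝ) / 16) (by norm_num) (by norm_num)).trans ?_
  rw [one_div, inv_pow, pow_succ]
  have h16 : (0 : ℝ) < 16 ^ j := by positivity
  field_simp
  nlinarith

/-- The zeroth-order size is non-increasing in the scale. -/
theorem ct_twoLegBar_zero_anti {G : GeoConsts} {Q : EngConsts} (hG : G.WF) (hQ : Q.WF) (U : ℝ) {j n : ℕ} (hjn : j ≤ n) :
    twoLegBar G Q U 0 n ≤ twoLegBar G Q U 0 j := by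
  have hS : 0 ≤ G.S 0 := hG.2.2.2.2.2.2.2.2.2.2.2.2.2.2.2.2.2.1 0
  have hS' : 0 ≤ Q.S' 0 := hQ.2.2.2.2.1 0
  rw [ct_twoLegBar_zero_eq, ct_twoLegBar_zero_eq]
  refine mul_le_mul_of_nonneg_left ?_ (by positivity)
  exact inv_anti₀ (by positivity) (pow_le_pow_right₀ (by norm_num) hjn)


end Summit.HubbardSuperconductivity.HubbardSuperconductivity.Theorems.KLRegimeSplit

end
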